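import Literature.NumberTheory.GaloisRepresentations.ContinuousCohomologyTwistEulerCharacteristic
import Literature.NumberTheory.GaloisCohomology.RestrictedRamificationH2MuFinite
import Literature.NumberTheory.GaloisCohomology.RestrictedRamificationFiniteCohomologyTwoOfH2Mu
import Literature.NumberTheory.GaloisRepresentations.ContinuousH1FiniteOfBoundedIndex
import Literature.NumberTheory.GaloisRepresentations.ContinuousCohomologyTransport
import Literature.NumberTheory.GaloisRepresentations.FiniteQuotientInflation
import HarnessLib

/-!
# Tate's global Euler characteristic at a totally complex field: the prime-to-`p` base case
# (Milne ADT I Thm. 5.1, proof; NSW (8.7.4)) — finiteness inputs and open-subgroup plumbing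

Topic `NumberTheory/GaloisCohomology`; namespace `Literature.NumberTheory.GaloisCohomology`
(generic lemmas under `Literature.NumberTheory.GaloisRepresentations`).  Definitions with bodies and
theorems; no named fact, no `sorry`, no instance, no notation.

Setting of the Artin-induction reduction of Tate's formula (`TateGlobalEulerCharacteristicTCOfBase`,
hypothesis `hbase`): `K` a totally complex number field, `S ⊇ S_p` finite, `G_S = G_{K,S}`,
`ρ₀ ≅ μ_p` (`MuCarrier K p`), `W ≤ U ≤ G_S` with `W` open (normal) fixing `μ_p`.  The generic
base-case computation `ContinuousCohomologyTwistEulerCharacteristic.euler_characteristic_of_fixedCount`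
runs on the compact group `↥U` with its open subgroup `W.subgroupOf U` and needs the finiteness of
`𝓗ⁿ := Hⁿ(↥U, Maps(↥U ⧸ W, μ_p))` for `n ≤ 2`.  This file supplies it:

* §1 `subgroupOfContinuousMulEquiv : ↥(W.subgroupOf U) ≃ₜ* ↥W` and the transport
  `Hⁿ(↥(W.subgroupOf U), A) ≃+ Hⁿ(↥W, A)` for restrictions of one `G`-representation
  (`continuousCohomologyRestrictSubgroupOfEquiv`, via `ContinuousCohomologyTransport`);
* §2 **`finite_continuousCohomology_coindOpen_subgroupOf_mu`**: `𝓗ⁿ` is finite for `n ≤ 2` — Shapiro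
  (`ContinuousShapiroOpenCoinduced`) down to `W`, then `n = 0` (finite coefficients), `n = 1` (Hermite:
  `finite_continuousCohomology_one_galoisGroupUnramifiedOutside`, through Shapiro up to `G_S`), `n = 2`
  (`finite_continuousCohomology_two_mu_of_isTotallyComplex`, the (H2μ-fin) input at totally complex `K`);
* index bookkeeping for `U = π⁻¹(C)`, `C ≤ G_S ⧸ W`: `[U : W] = #C`, `[G_S : U] = [G_S ⧸ W : C]`,
  compactness of `↥U`; and the `W`-triviality of `μ_p|_U` and of the inflated module `σ|_U`.

Lane «TATE-EPC-TC» (cell `bsd-eis`, stmt-BirchSwinnertonDyer-19032), brick B8-alg (E-final, part 1).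
HONEST FRAMING: plumbing and finiteness only; the Euler-characteristic identity itself is assembled in
the sequel from the equivariant Kummer computation (B8-arith); no case of BSD or of Tate's theorem is
proved by this file.

## References
* J. S. Milne, *Arithmetic Duality Theorems*, 2nd ed. (2006), I Thm. 5.1 (proof), Cor. 4.15. [MilneADT2006]
* J. Neukirch, A. Schmidt, K. Wingberg, *Cohomology of Number Fields*, 2nd ed. (2008), (8.3.20), (8.7.4). [NeukirchSchmidtWingberg2008]
* J.-P. Serre, *Galois Cohomology* (1997), I §2.4–2.5, III §4.1 Prop. 8. [SerreGaloisCohomology1997]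
-/

noncomputable section

open CategoryTheory Function
open scoped Topology

universe u

namespace Literature.NumberTheory.GaloisRepresentations

open _root_.TopRep _root_.ContRepresentation _root_.ContinuousCohomology

/-! ## §1 `↥(W.subgroupOf U) ≃ₜ* ↥W` and the transport of `Hⁿ` of restrictions -/

section SubgroupOf

variable {G : Type u} [Group G] [TopologicalSpace G] [IsTopologicalGroup G]
variable {A : Type u} [AddCommGroup A] [TopologicalSpace A] [DiscreteTopology A]
variable (ρ₀ : ContinuousRep G ℤ A) (W U : Subgroup G) (hWU : W ≤ U)

omit [IsTopologicalGroup G] [DiscreteTopology A] in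
/-- `↥(W.subgroupOf U) ≃ₜ* ↥W` for `W ≤ U` (Mathlib's `subgroupOfEquivOfLe`, continuous both ways).
[cite: SerreGaloisCohomology1997, I §2.4] -/
def subgroupOfContinuousMulEquiv : ↥(W.subgroupOf U) ≃ₜ* ↥W :=
  { Subgroup.subgroupOfEquivOfLe hWU with
    continuous_toFun := (continuous_subtype_val.comp continuous_subtype_val).subtype_mk _
    continuous_invFun := (continuous_subtype_val.subtype_mk _).subtype_mk _ }

omit [IsTopologicalGroup G] [DiscreteTopology A] in
/-- Formula. [cite: SerreGaloisCohomology1997, I §2.4] -/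
@[simp] theorem subgroupOfContinuousMulEquiv_apply_coe (g : ↥(W.subgroupOf U)) :
    ((subgroupOfContinuousMulEquiv W U hWU g : ↥W) : G) = ((g : ↥U) : G) := rfl

omit [IsTopologicalGroup G] [DiscreteTopology A] in
/-- Formula for the inverse. [cite: SerreGaloisCohomology1997, I §2.4] -/
@[simp] theorem subgroupOfContinuousMulEquiv_symm_apply_coe_coe (g : ↥W) :
    ((((subgroupOfContinuousMulEquiv W U hWU).symm g : ↥(W.subgroupOf U)) : ↥U) : G) = (g : G) := rfl

/-- The identity of `A` as a morphism `res (e⁻¹) (ρ₀|_U|_{W ∩ U}) ⟶ ρ₀|_W` over `↥W`.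
[cite: SerreGaloisCohomology1997, I §2.4] -/
def restrictSubgroupOfHom :
    TopRep.res (((subgroupOfContinuousMulEquiv W U hWU).symm : ↥W →ₜ* ↥(W.subgroupOf U)) :
        ↥W →* ↥(W.subgroupOf U))
      (((ρ₀.restrict (subgroupIncl U)).restrict (subgroupIncl (W.subgroupOf U))).toTopRep) ⟶
      (ρ₀.restrict (subgroupIncl W)).toTopRep :=
  TopRep.ofHom
    { toLinearMap := LinearMap.id
      cont := continuous_id
      isIntertwining' := fun _ => rfl }

/-- The identity of `A` as a morphism `res e (ρ₀|_W) ⟶ ρ₀|_U|_{W ∩ U}` over `↥(W.subgroupOf U)`.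
[cite: SerreGaloisCohomology1997, I §2.4] -/
def restrictSubgroupOfInv :
    TopRep.res (((subgroupOfContinuousMulEquiv W U hWU) : ↥(W.subgroupOf U) →ₜ* ↥W) :
        ↥(W.subgroupOf U) →* ↥W) (ρ₀.restrict (subgroupIncl W)).toTopRep ⟶
      ((ρ₀.restrict (subgroupIncl U)).restrict (subgroupIncl (W.subgroupOf U))).toTopRep :=
  TopRep.ofHom
    { toLinearMap := LinearMap.id
      cont := continuous_id
      isIntertwining' := fun _ => rfl }

/-- **`Hⁿ(↥(W.subgroupOf U), A) ≃+ Hⁿ(↥W, A)`** for the restrictions of one representation `ρ₀` of `G`.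
[cite: SerreGaloisCohomology1997, I §2.4] -/
def continuousCohomologyRestrictSubgroupOfEquiv (n : ℕ) :
    (continuousCohomology n
        ((ρ₀.restrict (subgroupIncl U)).restrict (subgroupIncl (W.subgroupOf U))).toTopRep : Type u) ≃+
      (continuousCohomology n (ρ₀.restrict (subgroupIncl W)).toTopRep : Type u) :=
  continuousCohomologyAddEquivOfContinuousMulEquiv (subgroupOfContinuousMulEquiv W U hWU)
    (restrictSubgroupOfHom ρ₀ W U hWU) (restrictSubgroupOfInv ρ₀ W U hWU) (fun _ => rfl) (fun _ => rfl) n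

include hWU in
/-- Finiteness transfer along `↥(W.subgroupOf U) ≃ₜ* ↥W`. [cite: SerreGaloisCohomology1997, I §2.4] -/
theorem finite_continuousCohomology_restrict_subgroupOf_iff (n : ℕ) :
    Finite (continuousCohomology n
        ((ρ₀.restrict (subgroupIncl U)).restrict (subgroupIncl (W.subgroupOf U))).toTopRep) ↔
      Finite (continuousCohomology n (ρ₀.restrict (subgroupIncl W)).toTopRep) :=
  Equiv.finite_iff (continuousCohomologyRestrictSubgroupOfEquiv ρ₀ W U hWU n).toEquiv

omit [IsTopologicalGroup G] [DiscreteTopology A] in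
/-- An open subgroup of a compact group is compact. [cite: SerreGaloisCohomology1997, I §1.1] -/
theorem compactSpace_subgroup_of_isOpen [ContinuousMul G] [CompactSpace G]
    (hU : IsOpen (U : Set G)) : CompactSpace ↥U :=
  isCompact_iff_compactSpace.mp (U.isClosed_of_isOpen hU).isCompact

omit [TopologicalSpace G] [IsTopologicalGroup G] in
/-- For `U = π⁻¹(C)`, `C ≤ G ⧸ W`: `#(↥U ⧸ W.subgroupOf U) = #C`. [cite: SerreGaloisCohomology1997, I §2.5] -/
theorem natCard_quotient_subgroupOf_comap [W.Normal] (C : Subgroup (G ⧸ W)) :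
    Nat.card (↥(C.comap (QuotientGroup.mk' W)) ⧸ W.subgroupOf (C.comap (QuotientGroup.mk' W))) =
      Nat.card C := by
  rw [← Subgroup.index_eq_card]
  change W.relIndex (C.comap (QuotientGroup.mk' W)) = Nat.card C
  calc W.relIndex (C.comap (QuotientGroup.mk' W))
      = ((⊥ : Subgroup (G ⧸ W)).comap (QuotientGroup.mk' W)).relIndex (C.comap (QuotientGroup.mk' W)) := by
        rw [MonoidHom.comap_bot, QuotientGroup.ker_mk']
    _ = (⊥ : Subgroup (G ⧸ W)).relIndex ((C.comap (QuotientGroup.mk' W)).map (QuotientGroup.mk' W)) :=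
        Subgroup.relIndex_comap _ _ _
    _ = Nat.card C := by
        rw [Subgroup.map_comap_eq_self_of_surjective (QuotientGroup.mk'_surjective W),
          Subgroup.relIndex_bot_left]

omit [TopologicalSpace G] [IsTopologicalGroup G] in
/-- For `U = π⁻¹(C)`: `[G : U] = [G ⧸ W : C]`. [cite: SerreGaloisCohomology1997, I §2.5] -/
theorem index_comap_mk' [W.Normal] (C : Subgroup (G ⧸ W)) :
    (C.comap (QuotientGroup.mk' W)).index = C.index :=
  C.index_comap_of_surjective (QuotientGroup.mk'_surjective W)

omit [TopologicalSpace G] [IsTopologicalGroup G] in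
/-- `W ≤ π⁻¹(C)`. [cite: SerreGaloisCohomology1997, I §2.5] -/
theorem le_comap_mk' [W.Normal] (C : Subgroup (G ⧸ W)) : W ≤ C.comap (QuotientGroup.mk' W) :=
  fun w hw => by
    rw [Subgroup.mem_comap, QuotientGroup.mk'_apply, (QuotientGroup.eq_one_iff w).mpr hw]
    exact one_mem C

omit [IsTopologicalGroup G] [DiscreteTopology A] in
/-- `μ_p|_U` is fixed by `W ∩ U` when `W` fixes it. [cite: MilneADT2006, I proof of Thm. 5.1] -/
theorem restrict_apply_eq_self_of_mem (hfix : ∀ g ∈ W, ∀ v : A, ρ₀ g v = v) :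
    ∀ w ∈ W.subgroupOf U, ∀ v : A, (ρ₀.restrict (subgroupIncl U)) w v = v :=
  fun w hw v => hfix (w : G) (Subgroup.mem_subgroupOf.mp hw) v

omit [IsTopologicalGroup G] in
/-- The inflated module `σ|_U` (`σ` a representation of `G ⧸ W`) is fixed by `W ∩ U`.
[cite: MilneADT2006, I proof of Thm. 5.1] -/
theorem inflate_restrict_apply_eq_self_of_mem [W.Normal] [DiscreteTopology (G ⧸ W)]
    {M : Type u} [AddCommGroup M] [TopologicalSpace M] [DiscreteTopology M]
    (σ : Representation ℤ (G ⧸ W) M) :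
    ∀ w ∈ W.subgroupOf U, ∀ m : M,
      (((ContinuousRep.ofDiscrete σ).restrict (ContinuousMonoidHom.quotientMk W)).restrict
        (subgroupIncl U)) w m = m := fun w hw m => by
  change σ (QuotientGroup.mk ((w : ↥U) : G)) m = m
  rw [(QuotientGroup.eq_one_iff ((w : ↥U) : G)).mpr (Subgroup.mem_subgroupOf.mp hw), map_one]
  rfl

end SubgroupOf

end Literature.NumberTheory.GaloisRepresentations

/-! ## §2 Finiteness of `Hⁿ(↥U, Maps(↥U ⧸ W, μ_p))`, `n ≤ 2`, at a totally complex `K` -/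

namespace Literature.NumberTheory.GaloisCohomology

open Literature.NumberTheory.GaloisRepresentations
open Literature.NumberTheory.GaloisRepresentations.DiscreteGaloisModule (mu MuCarrier)
open _root_.TopRep _root_.ContRepresentation _root_.ContinuousCohomology
open NumberField Field IsDedekindDomain
open scoped NumberField

variable {K : Type} [Field K] [NumberField K]

/-- **`Hⁿ(↥W, μ_p)` is finite for `n ≤ 2`**, `W ≤ G_{K,S}` open fixing `μ_p`, `K` totally complex,
`S ⊇ S_p` finite: `n = 0` finite coefficients, `n = 1` Hermite (through Shapiro up to `G_S`),
`n = 2` the (H2μ-fin) input. [cite: NeukirchSchmidtWingberg2008, (8.3.20)] [cite: MilneADT2006, I Cor. 4.15] -/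
theorem finite_continuousCohomology_restrict_mu [IsTotallyComplex K]
    (S : Set (HeightOneSpectrum (𝓞 K))) (hS : S.Finite) (p : ℕ) [Fact p.Prime]
    (hSp : ∀ v : HeightOneSpectrum (𝓞 K), ((p : ℕ) : 𝓞 K) ∈ v.asIdeal → v ∈ S)
    (ρ₀ : ContinuousRep (GaloisGroupUnramifiedOutside K S) ℤ (MuCarrier K p))
    (hρ₀ : ∀ (τ : absoluteGaloisGroup K) (v : MuCarrier K p), ρ₀ (toUnramifiedQuot K S τ) v = mu K p τ v)
    (W : Subgroup (GaloisGroupUnramifiedOutside K S)) (hWo : IsOpen (W : Set (GaloisGroupUnramifiedOutside K S)))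
    (hWfix : ∀ g ∈ W, ∀ v : MuCarrier K p, ρ₀ g v = v) (n : ℕ) (hn : n ≤ 2) :
    Finite (continuousCohomology n (ρ₀.restrict (subgroupIncl W)).toTopRep) := by
  haveI : Finite (MuCarrier K p) := finite_muCarrier p
  haveI : TotallyDisconnectedSpace (GaloisGroupUnramifiedOutside K S) :=
    Literature.GroupTheory.ProfiniteSubquotients.totallyDisconnectedSpace_quotient
      (ramificationSubgroup K S) (ramificationSubgroup_isClosed K S)
  rcases Nat.le_succ_iff.mp hn with hn | rfl
  · rcases Nat.le_succ_iff.mp hn with hn | rfl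
    · obtain rfl : n = 0 := Nat.le_zero.mp hn
      exact (ρ₀.restrict (subgroupIncl W)).finite_continuousCohomology_zero
    · -- `n = 1`: Shapiro up to `G_S` and Hermite
      rw [← ρ₀.finite_continuousCohomology_coindOpen_iff W hWo 1]
      haveI := ContinuousRep.discreteTopology_coindOpen (M := MuCarrier K p) W hWo
      haveI := ContinuousRep.finite_coindOpen (M := MuCarrier K p) W hWo
      exact finite_continuousCohomology_one_galoisGroupUnramifiedOutside hS (ρ₀.coindOpen W hWo)
  · exact finite_continuousCohomology_two_mu_of_isTotallyComplex S hS p hSp ρ₀ hρ₀ W hWo hWfix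

/-- **`Hⁿ(↥U, Maps(↥U ⧸ (W ∩ U), μ_p))` is finite for `n ≤ 2`** (`W ≤ U ≤ G_{K,S}`, `W` open fixing
`μ_p`, `K` totally complex, `S ⊇ S_p` finite): Shapiro down to `W ∩ U ≅ W` and
`finite_continuousCohomology_restrict_mu`. [cite: NeukirchSchmidtWingberg2008, (8.3.20)] [cite: MilneADT2006, I proof of Thm. 5.1] -/
theorem finite_continuousCohomology_coindOpen_subgroupOf_mu [IsTotallyComplex K]
    (S : Set (HeightOneSpectrum (𝓞 K))) (hS : S.Finite) (p : ℕ) [Fact p.Prime]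
    (hSp : ∀ v : HeightOneSpectrum (𝓞 K), ((p : ℕ) : 𝓞 K) ∈ v.asIdeal → v ∈ S)
    (ρ₀ : ContinuousRep (GaloisGroupUnramifiedOutside K S) ℤ (MuCarrier K p))
    (hρ₀ : ∀ (τ : absoluteGaloisGroup K) (v : MuCarrier K p), ρ₀ (toUnramifiedQuot K S τ) v = mu K p τ v)
    (W U : Subgroup (GaloisGroupUnramifiedOutside K S)) (hWU : W ≤ U)
    (hWo : IsOpen (W : Set (GaloisGroupUnramifiedOutside K S)))
    (hWfix : ∀ g ∈ W, ∀ v : MuCarrier K p, ρ₀ g v = v)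
    (hW' : IsOpen ((W.subgroupOf U : Subgroup ↥U) : Set ↥U)) [CompactSpace ↥U] (n : ℕ) (hn : n ≤ 2) :
    Finite (continuousCohomology n ((ρ₀.restrict (subgroupIncl U)).coindOpen (W.subgroupOf U) hW').toTopRep) := by
  haveI : TotallyDisconnectedSpace (GaloisGroupUnramifiedOutside K S) :=
    Literature.GroupTheory.ProfiniteSubquotients.totallyDisconnectedSpace_quotient
      (ramificationSubgroup K S) (ramificationSubgroup_isClosed K S)
  rw [(ρ₀.restrict (subgroupIncl U)).finite_continuousCohomology_coindOpen_iff (W.subgroupOf U) hW' n,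
    finite_continuousCohomology_restrict_subgroupOf_iff ρ₀ W U hWU n]
  exact finite_continuousCohomology_restrict_mu S hS p hSp ρ₀ hρ₀ W hWo hWfix n hn

end Literature.NumberTheory.GaloisCohomology

end
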